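import Literature.Topology.FourManifolds.MilnorBoxDynamics
import Literature.Topology.FourManifolds.MilnorChartIndex
import Literature.Topology.FourManifolds.MilnorChartSplitting
import Literature.Topology.FourManifolds.InteriorFieldFlow
import Literature.Topology.FourManifolds.GradientLikeTurnAbout
import Literature.Topology.FourManifolds.MorseTurnAbout
import HarnessLib

/-!
# The stable and unstable sets of a critical point are swept out by the local discs:
# countably many smooth images of `ℝ^λ`, `ℝ^{n+1-λ}` (Milnor 1965, Def. 3.9)

Topic `Literature/Topology/FourManifolds` (fact seat
`provefact-Literature.Topology.FourManifolds.Cobordism.Milnor1965_simplyConnected_plusLevelTwo`;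
this file proves, in explicit form, the dimension leaves
`Literature.Topology.FourManifolds.Cobordism.Milnor1965_stableSet_subset_iUnion_image` and
`Literature.Topology.FourManifolds.Cobordism.Milnor1965_unstableSet_subset_iUnion_image` of
`HCobordismLevelSimplyConnected.lean`).  Everything here is **proved**.

Milnor, *Lectures on the h-cobordism theorem* (1965), Def. 3.9 (PDF p. 16): the left-hand disc
of a critical point `p` of index `λ` is *"the union of the segments of these integral curves
beginning in `S_L` and ending at `p`"*, a smoothly imbedded `λ`-disc; in the coordinates of
Def. 3.1 2) (`f = f(p) - |x⃗|² + |y⃗|²`, `ξ = (-x⃗, y⃗)`) the trajectories going to `p` are those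
on the disc `y⃗ = 0` (proof of Thm. 3.12, PDF p. 18: *"If `x⃗` or `y⃗` is zero this trajectory
is a straight line segment tending to the origin"*).

**The statement** (`Cobordism.stableSet_inter_slab_subset_iUnion_image`).  For a Morse function
`f` on a cobordism `c` with smooth gradient-like `ξ`, an open slab `f⁻¹(ℓ₀, ℓ₁)`, `0 < ℓ₀`,
`ℓ₁ < 1`, and a critical point `z` of index `k` in it: the part of the stable set of `z`
(`Literature.Topology.FourManifolds.stableSet`, the trajectories of `ξ` going to `z`) inside
the slab is covered by the countably many smooth images `gᵢ(Oᵢ)`, `i ∈ ℕ`, where `gᵢ` flows the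
local stable disc `{y⃗ = 0, |x⃗| < ε}` of a Milnor box about `z` backwards for time `i` along
the flow of the field cut off to the slab (`InteriorFieldFlow.lean`), and `Oᵢ ⊆ ℝᵏ` is that
disc read in the `x⃗`-coordinates (the preimage of the `ε`-ball under the tree's
`Literature.Topology.FourManifolds.lowerEmb`, `MilnorChartSplitting.lean`).  Indeed a trajectory
of `ξ` going to `z` from a point
of the slab stays in the slab (`f` increases to `f z`), so it is a flow line of the cut-off
field; it is eventually in the box with `y⃗ = 0`
(`MilnorBox.exists_mem_box_sqSumGE_eq_zero_of_tendsto`) and stays so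
(`MilnorBox.forall_mem_box_of_sqSumGE_eq_zero`), in particular at an integer time `i`; and
the number of contracting coordinates of the box is the Morse index
(`isMCriticalPt_and_morseIndex_eq_of_eq_milnorQuadratic`, `MilnorChartIndex.lean`).  The
unstable set is treated by the time-reversed twins.

## References

* J. Milnor, *Lectures on the h-cobordism theorem*, notes by L. Siebenmann and J. Sondow,
  Princeton Mathematical Notes (1965): Def. 3.1 (PDF p. 12), Def. 3.9 (PDF p. 16), proof of
  Thm. 3.12 (PDF p. 18).  Held: `lit read book:milnornd-lectures-h-cobordism-theorem`.
  [MilnorHCobordism1965]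
-/

open scoped Manifold ContDiff Topology
open Set Function Filter Metric

noncomputable section

namespace Literature.Topology.FourManifolds

universe u

/-! ### The stable set inside a slab -/

section Stable

variable {n : ℕ} {M N : Type u} [TopologicalSpace M] [ChartedSpace (EuclideanSpace ℝ (Fin n)) M]
  [TopologicalSpace N] [ChartedSpace (EuclideanSpace ℝ (Fin n)) N]

/-- **Milnor 1965, Def. 3.9: the trajectories going to a critical point of index `k` inside a
slab are swept out by the local stable `k`-disc.**  For a Morse function `f` on the cobordism
`c` with smooth gradient-like `ξ`, levels `0 < ℓ₀`, `ℓ₁ < 1`, and a critical point `z` of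
index `k` with `f z ∈ (ℓ₀, ℓ₁)`, the part of the stable set of `z` in the open slab
`f⁻¹(ℓ₀, ℓ₁)` is covered by countably many smooth images of open subsets of `ℝᵏ` (see the
module docstring for the proof). [cite: MilnorHCobordism1965, Def. 3.9 (PDF p. 16), with Def. 3.1 (PDF p. 12) and proof of Thm. 3.12 (PDF p. 18)] -/
theorem Cobordism.stableSet_inter_slab_subset_iUnion_image {c : Cobordism n M N} {f : c.W → ℝ}
    (hf : c.IsMorseFunction f)
    (ξ : Cₛ^∞⟮𝓡∂ (n + 1); EuclideanSpace ℝ (Fin (n + 1)), (TangentSpace (𝓡∂ (n + 1)) : c.W → Type)⟯)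
    (hξ : IsGradientLike (𝓡∂ (n + 1)) f ξ) {ℓ₀ ℓ₁ : ℝ} (hℓ₀ : 0 < ℓ₀) (hℓ₁ : ℓ₁ < 1)
    {k : ℕ} {z : c.W} (hz : z ∈ criticalSetOfIndex (𝓡∂ (n + 1)) f k)
    (hzℓ : f z ∈ Ioo ℓ₀ ℓ₁) :
    ∃ (g : ℕ → EuclideanSpace ℝ (Fin k) → c.W) (O : ℕ → Set (EuclideanSpace ℝ (Fin k))), (∀ i, IsOpen (O i)) ∧
      (∀ i, ContMDiffOn (𝓡 k) (𝓡∂ (n + 1)) ∞ (g i) (O i)) ∧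
      stableSet (𝓡∂ (n + 1)) ξ z ∩ f ⁻¹' Ioo ℓ₀ ℓ₁ ⊆ ⋃ i, g i '' O i := by
  have hfs : ContMDiff (𝓡∂ (n + 1)) 𝓘(ℝ, ℝ) ∞ f := hf.isMorse.contMDiff
  have hfd : MDifferentiable (𝓡∂ (n + 1)) 𝓘(ℝ, ℝ) f := hfs.mdifferentiable (by simp)
  -- the cut-off field and its flow
  set X : Π x : c.W, TangentSpace (𝓡∂ (n + 1)) x := Cobordism.slabField f ξ ℓ₀ ℓ₁ with hXdef
  have hXs : ContMDiff (𝓡∂ (n + 1)) (𝓡∂ (n + 1)).tangent ∞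
      fun x => (⟨x, X x⟩ : TangentBundle (𝓡∂ (n + 1)) c.W) :=
    Cobordism.contMDiff_slabField hfs ξ.contMDiff ℓ₀ ℓ₁
  obtain ⟨θ, hθ⟩ := hf.exists_isSmoothFlow_slabField ξ.contMDiff hℓ₀ hℓ₁
  have hflow : IsFlowOf (𝓡∂ (n + 1)) X θ := hθ.isFlowOf
  have hXξ : ∀ x ∈ f ⁻¹' Ioo ℓ₀ ℓ₁, X x = ξ x := fun x hx =>
    Cobordism.slabField_eq_of_mem_Icc hℓ₀ hℓ₁ (Ioo_subset_Icc_self hx)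
  -- a Milnor box about `z` for `(f, X)` inside the open slab
  have hO : IsOpen (f ⁻¹' Ioo ℓ₀ ℓ₁) := isOpen_Ioo.preimage hfs.continuous
  have hzint : (𝓡∂ (n + 1)).IsInteriorPoint z :=
    hf.isInteriorPoint_of_apply_mem_Ioo ⟨hℓ₀.trans hzℓ.1, hzℓ.2.trans hℓ₁⟩
  obtain ⟨D, hDO⟩ := hξ.exists_milnorBox_source_subset (X := X) hz.1 hzint hO hzℓ hXξ
  -- the number of contracting coordinates is the Morse index
  have hk : k = min (n + 1) D.k := by
    have h := (isMCriticalPt_and_morseIndex_eq_of_eq_milnorQuadratic (m := n + 1)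
      ((hfs.of_le (by norm_cast)).contMDiffAt) D.mem_maximalAtlas D.mem_source hzint D.apply_eq).2
    rw [← hz.2, h]
  have hkle : k ≤ n + 1 := by rw [hk]; exact min_le_left _ _
  -- notation for the chart
  set e := D.chart.extend (𝓡∂ (n + 1)) with he
  have htarget : e.target = (𝓡∂ (n + 1)) '' D.chart.target := by
    rw [he, OpenPartialHomeomorph.extend_target, ModelWithCorners.image_eq]
  -- the family: flow the local stable disc back for integer times
  set O : Set (EuclideanSpace ℝ (Fin k)) := lowerEmb k (n + 1) ⁻¹' ball (0 : EuclideanSpace ℝ (Fin (n + 1))) D.ε with hOdef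
  set g : ℕ → EuclideanSpace ℝ (Fin k) → c.W := fun i v => θ (-(i : ℝ), e.symm (e z + lowerEmb k (n + 1) v)) with hgdef
  have hOopen : IsOpen O := isOpen_ball.preimage (lowerEmb k (n + 1)).continuous
  have hmem_target : ∀ v ∈ O, e z + lowerEmb k (n + 1) v ∈ e.target := by
    intro v hv
    refine D.closedBall_subset (mem_closedBall.2 ?_)
    have h1 : dist (e z + lowerEmb k (n + 1) v) (e z) = ‖lowerEmb k (n + 1) v‖ := by
      rw [dist_eq_norm, add_sub_cancel_left]
    rw [h1]
    have h2 : ‖lowerEmb k (n + 1) v‖ < D.ε := by simpa [hOdef] using hv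
    linarith [D.eps_pos]
  refine ⟨g, fun _ => O, fun _ => hOopen, fun i => ?_, ?_⟩
  · -- smoothness of `g i` on `O`
    have h1 : ContMDiff (𝓡 k) 𝓘(ℝ, EuclideanSpace ℝ (Fin (n + 1))) ∞ fun v : EuclideanSpace ℝ (Fin k) => e z + lowerEmb k (n + 1) v :=
      contMDiff_const.add (lowerEmb k (n + 1)).contMDiff
    have h2 : ContMDiffOn 𝓘(ℝ, EuclideanSpace ℝ (Fin (n + 1))) (𝓡∂ (n + 1)) ∞ e.symm e.target := by
      rw [htarget]
      exact contMDiffOn_extend_symm D.mem_maximalAtlas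
    have h3 : ContMDiffOn (𝓡 k) (𝓡∂ (n + 1)) ∞ (fun v => e.symm (e z + lowerEmb k (n + 1) v)) O :=
      h2.comp h1.contMDiffOn fun v hv => hmem_target v hv
    exact (hθ.contMDiff_apply (-(i : ℝ))).comp_contMDiffOn h3
  · -- covering
    rintro x ⟨hxz, hxU⟩
    obtain ⟨γ, hγ0, hγ, hlim⟩ := hxz
    -- the trajectory stays in the slab, so it is a flow line of the cut-off field
    have hslab : ∀ t, 0 ≤ t → f (γ t) ∈ Ioo ℓ₀ ℓ₁ := by
      intro t ht
      have hmono := hξ.monotoneOn_comp hfd (convex_Ici 0) hγ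
      have h1 : f x ≤ f (γ t) := by
        simpa only [comp_apply, hγ0] using hmono (self_mem_Ici) (mem_Ici.2 ht) ht
      have h2 : f (γ t) ≤ f z :=
        hξ.apply_le_of_mem_stableSet hfd (mem_stableSet_of_isMIntegralCurveOn hγ hlim ht)
      exact ⟨hxU.1.trans_le h1, h2.trans_lt hzℓ.2⟩
    have hγX : IsMIntegralCurveOn γ X (Ici 0) := fun t ht => by
      rw [show X (γ t) = ξ (γ t) from hXξ _ (hslab t ht)]
      exact hγ t ht
    have hγθ : ∀ t, 0 ≤ t → γ t = θ (t, x) := fun t ht => by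
      rw [hθ.eq_of_isMIntegralCurveOn_Ici (hXs.of_le (by norm_cast)) hγX ht, hγ0]
    have hlimθ : Tendsto (fun t => θ (t, x)) atTop (𝓝 z) := by
      refine hlim.congr' ?_
      filter_upwards [eventually_ge_atTop (0 : ℝ)] with t ht using hγθ t ht
    -- eventually in the box on the stable disc; in particular at an integer time
    obtain ⟨T₀, hT₀box, hT₀B⟩ := D.exists_mem_box_sqSumGE_eq_zero_of_tendsto hflow hlimθ
    set i : ℕ := ⌈max T₀ 0⌉₊ with hidef
    have hiT₀ : T₀ ≤ i := (le_max_left T₀ 0).trans (Nat.le_ceil _)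
    have hconf := D.forall_mem_box_of_sqSumGE_eq_zero hflow hT₀box hT₀B ((i : ℝ) - T₀)
      (sub_nonneg.2 hiT₀)
    rw [hflow.map_add, sub_add_cancel] at hconf
    obtain ⟨hybox, hyB, -⟩ := hconf
    set y : c.W := θ ((i : ℝ), x) with hydef
    -- read `y` in the chart: `y = e.symm (e z + u)`, `u` on the stable disc
    set u : EuclideanSpace ℝ (Fin (n + 1)) := D.coord y with hudef
    have hyu : e.symm (e z + u) = y := D.symm_add_coord hybox.1
    have hu0 : ∀ j : Fin (n + 1), k ≤ (j : ℕ) → u j = 0 := fun j hj =>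
      apply_eq_zero_of_sqSumGE_eq_zero hyB (by rw [hk] at hj; omega)
    have huk : sqSumGE k u = 0 :=
      Finset.sum_eq_zero fun j hj => by rw [hu0 j (Finset.mem_filter.1 hj).2]; ring
    have hupad : lowerEmb k (n + 1) (lowerProj k (n + 1) u) = u :=
      lowerEmb_lowerProj_of_sqSumGE_eq_zero huk
    have hunorm : ‖u‖ < D.ε := by
      have h1 : ‖u‖ ^ 2 < D.ε ^ 2 := by
        rw [← sqSumLT_add_sqSumGE D.k u, hyB, add_zero]; exact hybox.2.1
      exact (pow_lt_pow_iff_left₀ (norm_nonneg u) D.eps_pos.le two_ne_zero).1 h1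
    refine mem_iUnion.2 ⟨i, lowerProj k (n + 1) u, ?_, ?_⟩
    · show lowerEmb k (n + 1) (lowerProj k (n + 1) u) ∈ ball (0 : EuclideanSpace ℝ (Fin (n + 1))) D.ε
      rw [hupad, mem_ball_zero_iff]; exact hunorm
    · show θ (-(i : ℝ), e.symm (e z + lowerEmb k (n + 1) (lowerProj k (n + 1) u))) = x
      rw [hupad, hyu, hydef, hflow.map_neg_map]

/-! ### The unstable set inside a slab, by turning about -/

/-- **Milnor 1965, Def. 3.9, right-hand version: the trajectories coming from a critical
point of index `k` inside a slab are swept out by the local unstable `(n + 1 - k)`-disc.**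
The unstable set of `ξ` is the stable set of `-ξ` (`unstableSet_eq_stableSet_neg`), which is
gradient-like for the Morse function `1 - f` of the turned-about cobordism `c.symm`
(`Cobordism.IsMorseFunction.symm`, `Cobordism.IsMorseFunction.isGradientLike_const_sub_neg`),
for which `z` has index `j`, `k + j = n + 1` (`Cobordism.IsMorseFunction.criticalSetOfIndex_one_sub`);
so `Cobordism.stableSet_inter_slab_subset_iUnion_image` applies with the slab
`(1 - ℓ₁, 1 - ℓ₀)`. [cite: MilnorHCobordism1965, Def. 3.9 (PDF p. 16), with Lemma 4.7 ("Replacing `f` by `-f` …", PDF p. 25)] -/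
theorem Cobordism.unstableSet_inter_slab_subset_iUnion_image {c : Cobordism n M N} {f : c.W → ℝ}
    (hf : c.IsMorseFunction f)
    (ξ : Cₛ^∞⟮𝓡∂ (n + 1); EuclideanSpace ℝ (Fin (n + 1)), (TangentSpace (𝓡∂ (n + 1)) : c.W → Type)⟯)
    (hξ : IsGradientLike (𝓡∂ (n + 1)) f ξ) {ℓ₀ ℓ₁ : ℝ} (hℓ₀ : 0 < ℓ₀) (hℓ₁ : ℓ₁ < 1)
    {k j : ℕ} (hkj : k + j = n + 1) {z : c.W} (hz : z ∈ criticalSetOfIndex (𝓡∂ (n + 1)) f k)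
    (hzℓ : f z ∈ Ioo ℓ₀ ℓ₁) :
    ∃ (g : ℕ → EuclideanSpace ℝ (Fin j) → c.W) (O : ℕ → Set (EuclideanSpace ℝ (Fin j))), (∀ i, IsOpen (O i)) ∧
      (∀ i, ContMDiffOn (𝓡 j) (𝓡∂ (n + 1)) ∞ (g i) (O i)) ∧
      unstableSet (𝓡∂ (n + 1)) ξ z ∩ f ⁻¹' Ioo ℓ₀ ℓ₁ ⊆ ⋃ i, g i '' O i := by
  -- turn about
  have hf' : c.symm.IsMorseFunction fun x => 1 - f x := hf.symm
  have hξ' : IsGradientLike (𝓡∂ (n + 1)) (fun x => 1 - f x) (⇑(-ξ)) := by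
    rw [ContMDiffSection.coe_neg]
    exact hf.isGradientLike_const_sub_neg hξ 1
  have hz' : z ∈ criticalSetOfIndex (𝓡∂ (n + 1)) (fun x => 1 - f x) j := by
    rw [hf.criticalSetOfIndex_one_sub (show j ≤ n + 1 by omega), show n + 1 - j = k by omega]
    exact hz
  have hzℓ' : (1 - f z) ∈ Ioo (1 - ℓ₁) (1 - ℓ₀) := ⟨by linarith [hzℓ.2], by linarith [hzℓ.1]⟩
  obtain ⟨g, O, hO, hg, hsub⟩ := Cobordism.stableSet_inter_slab_subset_iUnion_image
    (c := c.symm) hf' (-ξ) hξ' (by linarith) (by linarith) hz' hzℓ'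
  refine ⟨g, O, hO, hg, fun x hx => hsub ⟨?_, ?_⟩⟩
  · change x ∈ stableSet (𝓡∂ (n + 1)) (⇑(-ξ) : Π y : c.W, TangentSpace (𝓡∂ (n + 1)) y) z
    rw [ContMDiffSection.coe_neg, stableSet_neg]
    exact hx.1
  · exact ⟨by linarith [hx.2.2], by linarith [hx.2.1]⟩

end Stable

end Literature.Topology.FourManifolds
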